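import Mathlib
import HarnessLib
import Summits.ValiantsHypothesis.ValiantsHypothesis.Theses.MonotoneRestoration
import Literature.Computability.AlgebraicComplexity.ArithCircuit
import Literature.Computability.AlgebraicComplexity.ArithCircuitProofs
import Literature.Computability.AlgebraicComplexity.MonotoneStructure
import Literature.Computability.AlgebraicComplexity.PermanentIrreducible
import Literature.ModelTheory.FiniteModelTheory.CkEquiv
import Summits.ValiantsHypothesis.ValiantsHypothesis.Theorems.MonotoneRestorationMonotoneRestorationQPCosetCount
import Summits.ValiantsHypothesis.ValiantsHypothesis.Theorems.MonotoneRestorationMonotoneRestorationQPSymmetricLB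
import Summits.ValiantsHypothesis.ValiantsHypothesis.Theorems.MonotoneRestorationMonotoneRestorationQPSupportSymmetrisation
import Summits.ValiantsHypothesis.ValiantsHypothesis.Theorems.MonotoneRestorationMonotoneRestorationQPSparseRegime
import Summits.ValiantsHypothesis.ValiantsHypothesis.Theorems.MonotoneRestorationMonotoneRestorationQPBeta
import Literature.Computability.AlgebraicComplexity.SymmetricArithCircuit
import Literature.Computability.AlgebraicComplexity.DawarWilsenach2025Proofs
import Literature.GroupTheory.PermutationGroups.SmallIndexSubgroups
import Summits.ValiantsHypothesis.ValiantsHypothesis.Theorems.MonotoneRestorationQP.Negative.LoadBearing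
import Summits.ValiantsHypothesis.ValiantsHypothesis.Theorems.MonotoneRestorationMonotoneRestorationQPPermSupportCount

/-! TTRL-lite variant V19882 of stmt-ValiantsHypothesis-15886 (`stub_monotoneComputation_of_complexity`, move `lemma_proposal`) -/

namespace Summit.ValiantsHypothesis.ValiantsHypothesis.Theorems

open Summit.ValiantsHypothesis.ValiantsHypothesis.Theses.MonotoneRestoration
open Literature.Computability.AlgebraicComplexity

/-- TTRL-lite variant V19882 (lemma_proposal) of `stub_monotoneComputation_of_complexity`
(stmt-ValiantsHypothesis-15886): the deferral identity for weighted
sums over the semifield `NNReal` — for `a ≠ 0`, `a • U + b • V = a • (U + (b / a) • V)`.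
This is the rescaling step that lets a weighted sum gate be charged one multiplication; it uses
`a * (b / a) = b`, which needs inverses (it fails over the semiring `ℕ`). -/
theorem stub_monotoneComputation_of_complexity_var19882 :
    ∀ (σ : Type) (a b : NNReal) (U V : MvPolynomial σ NNReal),
      a ≠ 0 → a • U + b • V = a • (U + (b / a) • V) := by
  intro σ a b U V ha
  rw [smul_add, smul_smul, mul_div_cancel₀ b ha]

end Summit.ValiantsHypothesis.ValiantsHypothesis.Theorems
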